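/-
Copyright (c) 2026 the pub-hodgecm-mathlib formalisation cell (harness21).  Prover seat hodgecm-mathlib-F0P2-p02 (g14): road «S3-ram» (LEAD F0P3a-plan (g13); owner
F0P3a-p06 (g15); (Cnt2′) chair F0P3a-p07 (g14)), organ (z3)(c) kit — L1 «labels ⟹ strata» from an ABSTRACT NILPOTENCY TOKEN; 2026-09-02.
Text = ★ `DepthZeroKappaTransferTypeOneRamifiedJunctionLabels.hstr_of_labels` (junction pen F0P3a-p01 (g17)) with the eigenframe binders replaced by the token `hnil3`.
-/
import Literature.NumberTheory.Automorphic.UnitaryLatticeTreeFixedGrandchildrenSliceCountRamified   -- ★ G3⁺ (F0P2-p06): GC currency, root, tokens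
import Literature.NumberTheory.Automorphic.UnitaryLatticeTreeTypeTwoParent                     -- ★ `scaleLattice_one`
import Literature.NumberTheory.Automorphic.UnitaryLatticeTreeFixedVertex                        -- ★ `scaleLattice_scaleLattice`
import Literature.NumberTheory.Automorphic.UnitaryLatticeTreeFramesOfInvolution                  -- ★ `isTree_latticeGraph_three_of_neg`
import Literature.NumberTheory.Automorphic.UnitaryLatticeTreeFixedGrandchildFrameRamified          -- ★ FILE L (F0P2-p01)
import Literature.NumberTheory.Automorphic.UnitaryLatticeTreeTypeTwoGram                          -- ★ `isIntMatrix_mul`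
import Literature.NumberTheory.Automorphic.UnitaryLatticeTreeNilpotencyTokenOfDepths               -- ★ ROW-N (F0P3-p03)
import Literature.NumberTheory.Automorphic.UnitaryLatticeTreeRankOneVertexOneClassRamified         -- ★ ROW-1C (F0P3a-p05)
import Literature.NumberTheory.Automorphic.UnitaryLatticeTreeClassConstantDictionaryRamified        -- ★ 1C-TRANS + SGN-DICT (F0P3a-p05)
import Literature.NumberTheory.Automorphic.UnitaryLatticeTreeRootGrandchildLabelsRamified          -- ★ ROW-ROOT-LBL (F0P3a-p04)
import Literature.NumberTheory.Automorphic.UnitaryLatticeTreeRegionUpClosedRamified                 -- ★ S1 + row-free orientation (F0P3-p04)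
import Literature.NumberTheory.Rogawski1990.DepthZeroKappaTransferTypeOneRamifiedTreeInduction      -- ★ ENGINE (F0P3a-p01 (g16)); brings ★ G1 `exists_rooted_parent`
import Literature.NumberTheory.Automorphic.UnitaryLatticeTreeFixedChildrenShallowerRamified        -- ★ `lev_mono_of_le` (F0P2-p01)
import Literature.NumberTheory.Automorphic.UnitaryLatticeTreeOrientationOfRowsRamified             -- ★ L2 `dep_lt_and_exists_orientation` (F0P2-p01)
import HarnessLib
import HarnessLib

/-!
# The ramified `κ`-orbital integral, junction kit: L1 «LABELS ⟹ STRATA» FROM AN ABSTRACT NILPOTENCY TOKEN (literal-agnostic; for the type-(2) tube)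
# (Kottwitz 1986 §3; Rogawski 1990 §4.9)

Topic `NumberTheory/Rogawski1990`; namespace `Literature.NumberTheory.Rogawski1990.TypeOneRamifiedJunction`.  THEOREMS ONLY (no definition, no instance, no notation, no named
fact, no `sorry`); kernel lane `--supports stmt-HodgeConjecture-24833`.  Cell `pub/hodgecm-mathlib` (D-0151), crux H413; road «S3-ram» (Literature seeding, count-neutral).

WHY THIS FILE.  The junction's L1 ★ `hstr_of_labels` (the `hstr` binder of the ★ engines: the five strata `str j` agree with the label characterisation `(dep, rk, cl)` at every fixed
self-dual vertex) uses the eigenframe `γ = A·diag(s)·A⁻¹` at ONE point — the nilpotency token `LEV₃[w](ϖ⁴)` at depth one (★ ROW-N over ★ `charpoly_of_eigenframe`).  As with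
★ L3-AGN (`engineRows_of_rows_of_nilToken`, this seat p848110), THIS FILE restates it with `(A _hA _hA' s hs1 hγA) (D) (hD2) (heD)` replaced by `(D) (hD2) (hnil3)`, proof verbatim
otherwise: **`hstr_of_labels_of_nilToken`** — so a literal without a `K`-eigenframe (the type-(2) `ι(γ₂, u)`, token by ★ ROW-N's block twin) gets its `hstr` too.

HONEST LABEL: HC_CM is proved only modulo the 2 remaining named inputs (hLiu418 24832, h413 24833) until rung 0 closes; nothing printed is asserted here (label bookkeeping).

## References
* [Kottwitz1986] R. E. Kottwitz, *Base change for unit elements of Hecke algebras*, Compositio Math. 60 (1986), §3.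
* [Rogawski1990] J. D. Rogawski, *Automorphic Representations of Unitary Groups in Three Variables*, Ann. of Math. Stud. 123 (1990), §4.9 pp. 54–56.
-/

set_option autoImplicit false

noncomputable section

open scoped Valued WithZero Matrix MatrixGroups
open Polynomial Classical SimpleGraph
open Literature.Combinatorics.SimpleGraph.TreeLayers
open Literature.NumberTheory.Automorphic Literature.NumberTheory.Automorphic.HermitianLattice Literature.NumberTheory.Automorphic.UnitaryLatticeTree

namespace Literature.NumberTheory.Rogawski1990.TypeOneRamifiedJunction

variable {K : Type*} [Field K] [Valued K ℤᵐ⁰] {σ : K →+* K} {ϖ : K}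

/-- **L1 «LABELS ⟹ STRATA» from the nilpotency token.**  ★ `hstr_of_labels` with the eigenframe replaced by `hnil3 : ∀ w d, d + 1 ≤ D → LEV[w](ϖ^d) → LEV₃[w](ϖ^(3d+1))`
(used once, at `d = 1`): at every fixed self-dual vertex the five strata `str j` (bd ∕ reg ∕ 1⁺ ∕ 1⁻ ∕ 0, given by their level∕class tokens `hstr0…hstr4`) agree with the
`(dep, rk, cl)` characterisation of the ★ engines. [cite: Kottwitz1986, §3] [cite: Rogawski1990, §4.9 pp. 54–56] -/
theorem hstr_of_labels_of_nilToken (hσ : ∀ x, σ (σ x) = x) (hvσ : ∀ a, Valued.v (σ a) = Valued.v a) (hσϖ : σ ϖ = -ϖ)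
    (hϖ : Valued.v ϖ = WithZero.exp (-1 : ℤ)) (hres : ∀ x : K, Valued.v x ≤ 1 → Valued.v (σ x - x) < 1) (h2 : Valued.v (2 : K) = 1) [Finite 𝓀[K]]
    (_hT : (latticeGraph σ ϖ ((StdForm.antidiagonal 3).over K)).IsTree)
    {γ : unitaryGroupOfForm σ ((StdForm.antidiagonal 3).over K)} (hγ0 : γ ∈ unitaryInt σ ((StdForm.antidiagonal 3).over K))
    (D : ℕ) (hD2 : 2 ≤ D) (hnil3 : ∀ (w : {M : Submodule 𝒪[K] (Fin 3 → K) // IsVertex σ ϖ ((StdForm.antidiagonal 3).over K) M}) (d : ℕ), d + 1 ≤ D →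
      w.1.map ((Matrix.toLin' (((γ : GL (Fin 3) K) : Matrix (Fin 3) (Fin 3) K) - 1)).restrictScalars 𝒪[K]) ≤ scaleLattice (ϖ ^ d) w.1 →
      w.1.map ((Matrix.toLin' ((((γ : GL (Fin 3) K) : Matrix (Fin 3) (Fin 3) K) - 1) ^ 3)).restrictScalars 𝒪[K]) ≤ scaleLattice (ϖ ^ (3 * d + 1)) w.1)
    (c₁ ε : K) (hc₁ : Valued.v c₁ = 1) (hεv : Valued.v ε = 1) (hε : ∀ z : K, Valued.v z ≤ 1 → Valued.v (z ^ 2 - ε) = 1)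
    (B : ℕ) (dep rk : {M : Submodule 𝒪[K] (Fin 3 → K) // IsVertex σ ϖ ((StdForm.antidiagonal 3).over K) M} → ℕ) (cl : {M : Submodule 𝒪[K] (Fin 3 → K) // IsVertex σ ϖ ((StdForm.antidiagonal 3).over K) M} → ℤ)
    (hdep : ∀ w : {M : Submodule 𝒪[K] (Fin 3 → K) // IsVertex σ ϖ ((StdForm.antidiagonal 3).over K) M}, latticeGraphIso σ ϖ ((StdForm.antidiagonal 3).over K) γ w = w → ∀ e, e ≤ dep w ↔ e ≤ B ∧ w.1.map ((Matrix.toLin' (((γ : GL (Fin 3) K) : Matrix (Fin 3) (Fin 3) K) - 1)).restrictScalars 𝒪[K]) ≤ scaleLattice (ϖ ^ e) w.1)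
    (hrk : ∀ w : {M : Submodule 𝒪[K] (Fin 3 → K) // IsVertex σ ϖ ((StdForm.antidiagonal 3).over K) M}, rk w = if w.1.map ((Matrix.toLin' ((((γ : GL (Fin 3) K) : Matrix (Fin 3) (Fin 3) K) - 1) ^ 2)).restrictScalars 𝒪[K]) ≤ scaleLattice (ϖ ^ (2 * dep w + 1)) w.1 then 1 else 2)
    (hcl : ∀ w : {M : Submodule 𝒪[K] (Fin 3 → K) // IsVertex σ ϖ ((StdForm.antidiagonal 3).over K) M}, cl w = if (∃ y ∈ w.1, ∃ a : K, Valued.v a = 1 ∧ Valued.v ((ϖ ^ (dep w))⁻¹ * pairing σ ((StdForm.antidiagonal 3).over K) y ((((γ : GL (Fin 3) K) : Matrix (Fin 3) (Fin 3) K) - 1) *ᵥ y) - (c₁) * a ^ 2) < 1) then (1 : ℤ) else -1)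
    (hB : 2 ≤ B)
    (str : Fin 5 → {M : Submodule 𝒪[K] (Fin 3 → K) // IsVertex σ ϖ ((StdForm.antidiagonal 3).over K) M} → Prop)
    (hstr0 : ∀ w, str 0 w ↔ ¬ w.1.map ((Matrix.toLin' (((γ : GL (Fin 3) K) : Matrix (Fin 3) (Fin 3) K) - 1)).restrictScalars 𝒪[K]) ≤ scaleLattice (ϖ) w.1)
    (hstr1 : ∀ w, str 1 w ↔ (w.1.map ((Matrix.toLin' (((γ : GL (Fin 3) K) : Matrix (Fin 3) (Fin 3) K) - 1)).restrictScalars 𝒪[K]) ≤ scaleLattice (ϖ) w.1 ∧ ¬ w.1.map ((Matrix.toLin' (((γ : GL (Fin 3) K) : Matrix (Fin 3) (Fin 3) K) - 1)).restrictScalars 𝒪[K]) ≤ scaleLattice (ϖ ^ 2) w.1 ∧ ¬ w.1.map ((Matrix.toLin' ((((γ : GL (Fin 3) K) : Matrix (Fin 3) (Fin 3) K) - 1) ^ 2)).restrictScalars 𝒪[K]) ≤ scaleLattice (ϖ ^ 3) w.1))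
    (hstr2 : ∀ w, str 2 w ↔ (w.1.map ((Matrix.toLin' (((γ : GL (Fin 3) K) : Matrix (Fin 3) (Fin 3) K) - 1)).restrictScalars 𝒪[K]) ≤ scaleLattice (ϖ) w.1 ∧ ¬ w.1.map ((Matrix.toLin' (((γ : GL (Fin 3) K) : Matrix (Fin 3) (Fin 3) K) - 1)).restrictScalars 𝒪[K]) ≤ scaleLattice (ϖ ^ 2) w.1 ∧ w.1.map ((Matrix.toLin' ((((γ : GL (Fin 3) K) : Matrix (Fin 3) (Fin 3) K) - 1) ^ 2)).restrictScalars 𝒪[K]) ≤ scaleLattice (ϖ ^ 3) w.1 ∧ ∃ y ∈ w.1, ∃ a : K, Valued.v a = 1 ∧ Valued.v (ϖ⁻¹ * pairing σ ((StdForm.antidiagonal 3).over K) y ((((γ : GL (Fin 3) K) : Matrix (Fin 3) (Fin 3) K) - 1) *ᵥ y) - c₁ * a ^ 2) < 1))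
    (hstr3 : ∀ w, str 3 w ↔ (w.1.map ((Matrix.toLin' (((γ : GL (Fin 3) K) : Matrix (Fin 3) (Fin 3) K) - 1)).restrictScalars 𝒪[K]) ≤ scaleLattice (ϖ) w.1 ∧ ¬ w.1.map ((Matrix.toLin' (((γ : GL (Fin 3) K) : Matrix (Fin 3) (Fin 3) K) - 1)).restrictScalars 𝒪[K]) ≤ scaleLattice (ϖ ^ 2) w.1 ∧ w.1.map ((Matrix.toLin' ((((γ : GL (Fin 3) K) : Matrix (Fin 3) (Fin 3) K) - 1) ^ 2)).restrictScalars 𝒪[K]) ≤ scaleLattice (ϖ ^ 3) w.1 ∧ ∃ y ∈ w.1, ∃ a : K, Valued.v a = 1 ∧ Valued.v (ϖ⁻¹ * pairing σ ((StdForm.antidiagonal 3).over K) y ((((γ : GL (Fin 3) K) : Matrix (Fin 3) (Fin 3) K) - 1) *ᵥ y) - (c₁ * ε) * a ^ 2) < 1))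
    (hstr4 : ∀ w, str 4 w ↔ w.1.map ((Matrix.toLin' (((γ : GL (Fin 3) K) : Matrix (Fin 3) (Fin 3) K) - 1)).restrictScalars 𝒪[K]) ≤ scaleLattice (ϖ ^ 2) w.1)
    (w : {M : Submodule 𝒪[K] (Fin 3 → K) // IsVertex σ ϖ ((StdForm.antidiagonal 3).over K) M}) (hw : IsSelfDualLattice σ ϖ ((StdForm.antidiagonal 3).over K) w.1) (hfix : latticeGraphIso σ ϖ ((StdForm.antidiagonal 3).over K) γ w = w) :
    (str 0 w ↔ dep w = 0) ∧ (str 1 w ↔ dep w = 1 ∧ rk w = 2) ∧ (str 2 w ↔ dep w = 1 ∧ rk w = 1 ∧ cl w = 1) ∧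
      (str 3 w ↔ dep w = 1 ∧ rk w = 1 ∧ cl w = -1) ∧ (str 4 w ↔ 2 ≤ dep w) := by
  have hϖ1 : Valued.v ϖ ≤ 1 := by rw [hϖ, ← WithZero.exp_zero]; exact WithZero.exp_le_exp.2 (by norm_num)
  have hB1 : 1 ≤ B := by omega
  -- depth characterisations
  have h1 : 1 ≤ dep w ↔ w.1.map ((Matrix.toLin' (((γ : GL (Fin 3) K) : Matrix (Fin 3) (Fin 3) K) - 1)).restrictScalars 𝒪[K]) ≤ scaleLattice (ϖ) w.1 := by
    rw [hdep w hfix 1, pow_one]; exact ⟨fun h => h.2, fun h => ⟨hB1, h⟩⟩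
  have hge2 : 2 ≤ dep w ↔ w.1.map ((Matrix.toLin' (((γ : GL (Fin 3) K) : Matrix (Fin 3) (Fin 3) K) - 1)).restrictScalars 𝒪[K]) ≤ scaleLattice (ϖ ^ 2) w.1 := by
    rw [hdep w hfix 2]; exact ⟨fun h => h.2, fun h => ⟨hB, h⟩⟩
  have hd0 : dep w = 0 ↔ ¬ w.1.map ((Matrix.toLin' (((γ : GL (Fin 3) K) : Matrix (Fin 3) (Fin 3) K) - 1)).restrictScalars 𝒪[K]) ≤ scaleLattice (ϖ) w.1 := by rw [← h1]; omega
  have hd1 : dep w = 1 ↔ w.1.map ((Matrix.toLin' (((γ : GL (Fin 3) K) : Matrix (Fin 3) (Fin 3) K) - 1)).restrictScalars 𝒪[K]) ≤ scaleLattice (ϖ) w.1 ∧ ¬ w.1.map ((Matrix.toLin' (((γ : GL (Fin 3) K) : Matrix (Fin 3) (Fin 3) K) - 1)).restrictScalars 𝒪[K]) ≤ scaleLattice (ϖ ^ 2) w.1 := by rw [← h1, ← hge2]; omega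
  -- rank and class at depth one
  have hrk1 : dep w = 1 → (rk w = 2 ↔ ¬ w.1.map ((Matrix.toLin' ((((γ : GL (Fin 3) K) : Matrix (Fin 3) (Fin 3) K) - 1) ^ 2)).restrictScalars 𝒪[K]) ≤ scaleLattice (ϖ ^ 3) w.1) := by
    intro hd; rw [hrk w, hd]; norm_num
  have hrk1' : dep w = 1 → (rk w = 1 ↔ w.1.map ((Matrix.toLin' ((((γ : GL (Fin 3) K) : Matrix (Fin 3) (Fin 3) K) - 1) ^ 2)).restrictScalars 𝒪[K]) ≤ scaleLattice (ϖ ^ 3) w.1) := by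
    intro hd; rw [hrk w, hd]; norm_num
  have hcl1 : dep w = 1 → (cl w = 1 ↔ ∃ y ∈ w.1, ∃ a : K, Valued.v a = 1 ∧ Valued.v (ϖ⁻¹ * pairing σ ((StdForm.antidiagonal 3).over K) y ((((γ : GL (Fin 3) K) : Matrix (Fin 3) (Fin 3) K) - 1) *ᵥ y) - c₁ * a ^ 2) < 1) := by
    intro hd; rw [hcl w, hd, pow_one]; norm_num
  have hcl1' : dep w = 1 → (cl w = -1 ↔ ¬ ∃ y ∈ w.1, ∃ a : K, Valued.v a = 1 ∧ Valued.v (ϖ⁻¹ * pairing σ ((StdForm.antidiagonal 3).over K) y ((((γ : GL (Fin 3) K) : Matrix (Fin 3) (Fin 3) K) - 1) *ᵥ y) - c₁ * a ^ 2) < 1) := by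
    intro hd; rw [hcl w, hd, pow_one]; norm_num
  -- ONE CLASS at a rank-one depth-one vertex (ROW-1C + ROW-N at depth 1)
  have h1C : dep w = 1 → rk w = 1 →
      ((¬ ∃ y ∈ w.1, ∃ a : K, Valued.v a = 1 ∧ Valued.v (ϖ⁻¹ * pairing σ ((StdForm.antidiagonal 3).over K) y ((((γ : GL (Fin 3) K) : Matrix (Fin 3) (Fin 3) K) - 1) *ᵥ y) - c₁ * a ^ 2) < 1) ↔
        ∃ y ∈ w.1, ∃ a : K, Valued.v a = 1 ∧ Valued.v (ϖ⁻¹ * pairing σ ((StdForm.antidiagonal 3).over K) y ((((γ : GL (Fin 3) K) : Matrix (Fin 3) (Fin 3) K) - 1) *ᵥ y) - (c₁ * ε) * a ^ 2) < 1) := by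
    intro hd hr
    have hlev1 : w.1.map ((Matrix.toLin' (((γ : GL (Fin 3) K) : Matrix (Fin 3) (Fin 3) K) - 1)).restrictScalars 𝒪[K]) ≤ scaleLattice (ϖ ^ 1) w.1 := by rw [pow_one]; exact (hd1.1 hd).1
    have hlev2 : ¬ w.1.map ((Matrix.toLin' (((γ : GL (Fin 3) K) : Matrix (Fin 3) (Fin 3) K) - 1)).restrictScalars 𝒪[K]) ≤ scaleLattice (ϖ ^ (1 + 1)) w.1 := (hd1.1 hd).2
    have hrk3 : w.1.map ((Matrix.toLin' ((((γ : GL (Fin 3) K) : Matrix (Fin 3) (Fin 3) K) - 1) ^ 2)).restrictScalars 𝒪[K]) ≤ scaleLattice (ϖ ^ (2 * 1 + 1)) w.1 := (hrk1' hd).1 hr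
    have hnil : w.1.map ((Matrix.toLin' ((((γ : GL (Fin 3) K) : Matrix (Fin 3) (Fin 3) K) - 1) ^ 3)).restrictScalars 𝒪[K]) ≤ scaleLattice (ϖ ^ (3 * 1 + 1)) w.1 := hnil3 w 1 hD2 hlev1
    have h := class_xor_class_mul_of_fixed_selfDual_rankOne hσ hvσ hσϖ hϖ hres h2 hγ0 hw hfix (d := 1) le_rfl hlev1 hlev2 hrk3 hnil c₁ ε hc₁ hεv hε
    simp only [pow_one] at h
    obtain ⟨hor, hnand⟩ := h
    constructor
    · intro hn; exact hor.resolve_left hn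
    · intro hε' hc; exact hnand ⟨hc, hε'⟩
  refine ⟨?_, ?_, ?_, ?_, ?_⟩
  · rw [hstr0, hd0]
  · rw [hstr1]
    constructor
    · rintro ⟨hl1, hl2, hr⟩
      have hd : dep w = 1 := hd1.2 ⟨hl1, hl2⟩
      exact ⟨hd, (hrk1 hd).2 hr⟩
    · rintro ⟨hd, hr⟩
      exact ⟨(hd1.1 hd).1, (hd1.1 hd).2, (hrk1 hd).1 hr⟩
  · rw [hstr2]
    constructor
    · rintro ⟨hl1, hl2, hr, hc⟩
      have hd : dep w = 1 := hd1.2 ⟨hl1, hl2⟩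
      exact ⟨hd, (hrk1' hd).2 hr, (hcl1 hd).2 hc⟩
    · rintro ⟨hd, hr, hc⟩
      exact ⟨(hd1.1 hd).1, (hd1.1 hd).2, (hrk1' hd).1 hr, (hcl1 hd).1 hc⟩
  · rw [hstr3]
    constructor
    · rintro ⟨hl1, hl2, hr, hc⟩
      have hd : dep w = 1 := hd1.2 ⟨hl1, hl2⟩
      have hr' : rk w = 1 := (hrk1' hd).2 hr
      exact ⟨hd, hr', (hcl1' hd).2 ((h1C hd hr').2 hc)⟩
    · rintro ⟨hd, hr, hc⟩
      exact ⟨(hd1.1 hd).1, (hd1.1 hd).2, (hrk1' hd).1 hr, (h1C hd hr).1 ((hcl1' hd).1 hc)⟩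
  · rw [hstr4, hge2]

end Literature.NumberTheory.Rogawski1990.TypeOneRamifiedJunction

end
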